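import Summits.QuantumFields.BalabanUV.Beta.GAN24.DerivativeRateTransferAnalyticResolvent

/-!
# `BalabanUV.Beta.GAN24.DerivativeRateTransferAnalyticSchur` — binder row G-an2-4 ∕ (CONV-C), route R6 «VALUES, NOT DERIVATIVES», PART 11:
# S2ω AT MODEL LEVEL FOR THE SCHUR-COMPLEMENT (Σ) AND OFF-DIAGONAL (Ξ) BLOCKS OF THE KKT INVERSE — «analyticity passes through the Schur
# complement»: for `K(z) = 1 + T(z)` holomorphic with `‖T‖ ≤ ϑ < 1` and a constraint pair `Q : F →L G`, `R : G →L F` with `Q ∘ R = 1`, the block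
# `Σ(z) = (Q K(z)⁻¹ R)⁻¹` is `(1 + E(z))⁻¹` with `E(z) = Q (K(z)⁻¹ − 1) R` HOLOMORPHIC and `‖E(z)‖ ≤ ‖Q‖‖R‖ϑ∕(1−ϑ)` — so PART 10 §1 applies VERBATIM to
# `E`: every entry of `Σ(z)` and of `Ξ(z) = Σ(z) Q K(z)⁻¹` is jointly holomorphic with ONE bound; PART 8's `hF`∕`hB` for the Σ∕Ξ u-rows
# (unit b2b-balaban-gan24-p3, gen 34; v1)

NOT IN PRINT; OUR PROOF (for the ROUTE; [folklore] — `B8SectDSource` §3 Neumann API and Mathlib `DifferentiableAt.inverse` ∕ `clm_comp` ∕ `clm_apply`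
BY NAME; PART 10 §1 BY NAME).  HONEST FRAMING (cell contract, verbatim): «discharging `BetaPertH` makes Bałaban's UV stability UNCONDITIONAL — a real
constructive-QFT result; it is NOT the continuum limit and NOT the Clay problem.»  HONEST DEPENDENCY (verbatim): «continuum YM on T⁴ ⇐ BetaPertH ∧ nine
spine estimates (0/9 proved); BetaPertH ⇐ (D1) ∧ (D4) ∧ CAP+tail; G-an2-4 gates asym, D1 and NE2/3/4.»

WHY THIS FILE.  AN1 §3's block inverse `M_k⁻¹ = [[Γ, Ξᵀ],[Ξ, −Σ]]` of the KKT operator `[[K, Qᵀ],[Q, 0]]` has, besides the resolvent-type block, the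
SCHUR-COMPLEMENT block `Σ = (Q K⁻¹ Qᵀ)⁻¹` (the one-step effective form) and the off-diagonal block `Ξ = Σ Q K⁻¹` (the minimiser map) — an1's
`Beta.Envelope` ∕ `BorderedJets` objects (real, finite-dimensional; not imported here).  PART 10 carried S2ω (joint holomorphy + one bound on the
bidisc) from an operator family `K(z) = 1 + T(z)` to the entries of `K(z)⁻¹`.  THIS FILE carries it through the Schur complement: with a
normalised constraint pair `Q R = 1` (model of `Q Q* = 1` after rescaling), `Q K(z)⁻¹ R = 1 + E(z)`, `E(z) := Q (K(z)⁻¹ − 1) R`, and `E` is holomorphic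
with `‖E(z)‖ ≤ ‖Q‖‖R‖·ϑ∕(1−ϑ)` — small when `ϑ` is; so `Σ(z) = (1 + E(z))⁻¹` is PART 10's resolvent of the family `E`, and `Ξ(z)`'s entries are
products of holomorphic bounded factors.  MODEL LEVEL: nothing of Bałaban's `M_k(B)` is asserted; the identification is S2's dictionary.

WHAT THIS FILE PROVES (0 sorry, 0 `def`; `F, G` complex Banach spaces; `T : E → (F →L[ℂ] F)` on any complex normed parameter space `E` (`ℂ × ℂ` for the two-bond family, `ℂ` for one bond); `Q : F →L[ℂ] G`, `R : G →L[ℂ] F`):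
* §1 [folklore] the resolvent as a CLM-valued holomorphic map `differentiableOn_inverse_one_add`; the deviation identity
  `inverse_one_add_sub_one : (1 + S)⁻¹ʳ − 1 = −((1 + S)⁻¹ʳ * S)` and its bound `norm_inverse_one_add_sub_one_le : ‖(1 + S)⁻¹ʳ − 1‖ ≤ ϑ∕(1−ϑ)` (`‖S‖ ≤ ϑ < 1`);
* §2 the Schur deviation `E(z) = Q ∘L ((1 + T z)⁻¹ʳ − 1) ∘L R`: **`schur_eq`** (`Q R = 1 ⇒ Q ∘L (1 + T z)⁻¹ʳ ∘L R = 1 + E z`), **`norm_schurDev_le`**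
  (`‖E z‖ ≤ ‖Q‖·‖R‖·ϑ∕(1−ϑ)`), **`differentiableOn_schurDev`** (`E` holomorphic where `T` is);
* §3 THE Σ BLOCK: **`differentiableOn_sigmaEntry`** ∕ **`norm_sigmaEntry_le`** — `z ↦ ψ ((1 + E z)⁻¹ʳ g)` jointly holomorphic on `U` with the one bound
  `‖ψ‖‖g‖∕(1 − ϑ′)` whenever `‖Q‖‖R‖ϑ∕(1−ϑ) ≤ ϑ′ < 1` (PART 10 §1 applied to `E`);
* §4 THE Ξ BLOCK: **`differentiableOn_xiEntry`** ∕ **`norm_xiEntry_le`** — `z ↦ ψ ((1 + E z)⁻¹ʳ (Q ((1 + T z)⁻¹ʳ f)))` jointly holomorphic with the bound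
  `‖ψ‖·‖Q‖·‖f‖∕((1−ϑ′)(1−ϑ))`.
WHAT IT DOES NOT DO: S1; the dictionary to Bałaban's blocks (an1's `Envelope.value`∕`minMap`∕`flucCov` are REAL finite-dimensional — the complexification +
the normalisation `Q R = 1` + `k`-uniform smallness are S2's debt); the Γ block's Schur correction `K⁻¹RΣQK⁻¹` (same mechanism, one more product —
left to a consumer); decay.  SUPPLIER work on route R6 (rank 2, KEEP-AS-REDUCTION, no seat); no consumer of record; NOT one of the nine spine
estimates; NEVER «G-an2-4 closed»; NOT (CONV-C), NOT D1, NOT `BetaPertH`, NOT continuum, NOT Clay.  Records: `HOME/b2b-balaban-gan24-p3/WOODBURY-FIBRE.md` v13.4.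
-/

noncomputable section
open Set Metric
open scoped Ring

namespace Summit.QuantumFields.BalabanUV.Beta.GAN24.DerivativeRateTransferAnalyticSchur

open Literature.MathematicalPhysics.QuantumFieldTheory.Balaban1983to89.B8SectDSource
  (isUnit_one_add norm_inverse_one_add_le norm_inverse_one_add_apply_le)
open Summit.QuantumFields.BalabanUV.Beta.GAN24.DerivativeRateTransferAnalyticResolvent
  (differentiableOn_resolventEntry norm_resolventEntry_le)

variable {F G : Type*} [NormedAddCommGroup F] [NormedSpace ℂ F] [CompleteSpace F]
  [NormedAddCommGroup G] [NormedSpace ℂ G] [CompleteSpace G]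

/-! ## §1 The resolvent as a CLM-valued holomorphic map; its deviation from the identity -/

section ResolventCLM

variable {E : Type*} [NormedAddCommGroup E] [NormedSpace ℂ E] {T : E → (F →L[ℂ] F)} {U : Set E}

/-- [folklore] `T` holomorphic on the open `U` (any complex normed parameter space `E`; `ℂ × ℂ` for the two-bond family, `ℂ` for one bond) with `‖T z‖ < 1` ⇒ `z ↦ (1 + T z)⁻¹ʳ` is holomorphic on `U` as a CLM-valued map
(Mathlib `DifferentiableAt.inverse` at the unit `1 + T z`). -/
theorem differentiableOn_inverse_one_add (hU : IsOpen U) (hT : DifferentiableOn ℂ T U) (h1 : ∀ z ∈ U, ‖T z‖ < 1) :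
    DifferentiableOn ℂ (fun z => (1 + T z)⁻¹ʳ) U := fun z hz =>
  (((hT.differentiableAt (hU.mem_nhds hz)).const_add (1 : F →L[ℂ] F)).inverse
    (isUnit_one_add _ (h1 z hz))).differentiableWithinAt

/-- [folklore] THE DEVIATION IDENTITY: for `‖S‖ < 1`, `(1 + S)⁻¹ʳ − 1 = −((1 + S)⁻¹ʳ * S)` (from `(1 + S)⁻¹ʳ(1 + S) = 1`). -/
theorem inverse_one_add_sub_one (S : F →L[ℂ] F) (hS : ‖S‖ < 1) :
    (1 + S)⁻¹ʳ - 1 = -((1 + S)⁻¹ʳ * S) := by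
  have h1 : (1 + S)⁻¹ʳ * (1 + S) = 1 := Ring.inverse_mul_cancel _ (isUnit_one_add S hS)
  rw [mul_add, mul_one] at h1
  -- `A + A S = 1 ⇒ A − 1 = −(A S)`
  rw [sub_eq_iff_eq_add, neg_add_eq_sub, eq_sub_iff_add_eq]
  exact h1

/-- [folklore] THE DEVIATION BOUND: `‖S‖ ≤ ϑ < 1 ⇒ ‖(1 + S)⁻¹ʳ − 1‖ ≤ ϑ∕(1 − ϑ)`. -/
theorem norm_inverse_one_add_sub_one_le (S : F →L[ℂ] F) {ϑ : ℝ} (hS : ‖S‖ ≤ ϑ) (hϑ : ϑ < 1) :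
    ‖(1 + S)⁻¹ʳ - 1‖ ≤ ϑ / (1 - ϑ) := by
  have hϑ0 : 0 ≤ ϑ := (norm_nonneg S).trans hS
  rw [inverse_one_add_sub_one S (lt_of_le_of_lt hS hϑ), norm_neg]
  calc ‖(1 + S)⁻¹ʳ * S‖ ≤ ‖(1 + S)⁻¹ʳ‖ * ‖S‖ := norm_mul_le _ _
    _ ≤ 1 / (1 - ϑ) * ϑ := mul_le_mul (norm_inverse_one_add_le S hS hϑ) hS (norm_nonneg _) (by positivity)
    _ = ϑ / (1 - ϑ) := by ring

end ResolventCLM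

/-! ## §2 The Schur deviation `E(z) = Q ((1 + T z)⁻¹ − 1) R` for a normalised constraint pair `Q R = 1` -/

section SchurDev

variable {E : Type*} [NormedAddCommGroup E] [NormedSpace ℂ E] {T : E → (F →L[ℂ] F)} {U : Set E} (Q : F →L[ℂ] G) (R : G →L[ℂ] F)

omit [CompleteSpace F] [CompleteSpace G] [NormedAddCommGroup E] [NormedSpace ℂ E] in
/-- **`schur_eq` — THE SCHUR BLOCK AS A PERTURBATION OF THE IDENTITY** [folklore]: if `Q ∘L R = 1` then
`Q ∘L (1 + T z)⁻¹ʳ ∘L R = 1 + Q ∘L ((1 + T z)⁻¹ʳ − 1) ∘L R`. -/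
theorem schur_eq (hQR : Q.comp R = 1) (z : E) :
    Q.comp (((1 + T z)⁻¹ʳ).comp R) = 1 + Q.comp ((((1 + T z)⁻¹ʳ) - 1).comp R) := by
  rw [ContinuousLinearMap.sub_comp, ContinuousLinearMap.comp_sub, ContinuousLinearMap.one_def,
    ContinuousLinearMap.id_comp, ← ContinuousLinearMap.one_def, hQR]
  abel

omit [CompleteSpace G] [NormedAddCommGroup E] [NormedSpace ℂ E] in
/-- **`norm_schurDev_le` — THE SCHUR DEVIATION IS SMALL** [folklore]: `‖T z‖ ≤ ϑ < 1 ⇒ ‖Q ∘L ((1 + T z)⁻¹ʳ − 1) ∘L R‖ ≤ ‖Q‖·‖R‖·ϑ∕(1−ϑ)`. -/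
theorem norm_schurDev_le {ϑ : ℝ} {z : E} (hT : ‖T z‖ ≤ ϑ) (hϑ : ϑ < 1) :
    ‖Q.comp ((((1 + T z)⁻¹ʳ) - 1).comp R)‖ ≤ ‖Q‖ * ‖R‖ * (ϑ / (1 - ϑ)) := by
  have h := norm_inverse_one_add_sub_one_le (T z) hT hϑ
  calc ‖Q.comp ((((1 + T z)⁻¹ʳ) - 1).comp R)‖ ≤ ‖Q‖ * ‖(((1 + T z)⁻¹ʳ) - 1).comp R‖ :=
        ContinuousLinearMap.opNorm_comp_le _ _
    _ ≤ ‖Q‖ * (‖((1 + T z)⁻¹ʳ) - 1‖ * ‖R‖) := by gcongr; exact ContinuousLinearMap.opNorm_comp_le _ _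
    _ ≤ ‖Q‖ * (ϑ / (1 - ϑ) * ‖R‖) := by gcongr
    _ = ‖Q‖ * ‖R‖ * (ϑ / (1 - ϑ)) := by ring

omit [CompleteSpace G] in
/-- **`differentiableOn_schurDev` — THE SCHUR DEVIATION IS HOLOMORPHIC** [folklore]: `T` holomorphic on the open `U` with `‖T z‖ < 1` there ⇒
`z ↦ Q ∘L ((1 + T z)⁻¹ʳ − 1) ∘L R` is holomorphic on `U`. -/
theorem differentiableOn_schurDev (hU : IsOpen U) (hT : DifferentiableOn ℂ T U) (h1 : ∀ z ∈ U, ‖T z‖ < 1) :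
    DifferentiableOn ℂ (fun z => Q.comp ((((1 + T z)⁻¹ʳ) - 1).comp R)) U := by
  have hinv : DifferentiableOn ℂ (fun z => (1 + T z)⁻¹ʳ - (1 : F →L[ℂ] F)) U :=
    (differentiableOn_inverse_one_add hU hT h1).sub_const 1
  have h2 : DifferentiableOn ℂ (fun z => (((1 + T z)⁻¹ʳ) - 1).comp R) U := hinv.clm_comp (differentiableOn_const R)
  exact (differentiableOn_const Q).clm_comp h2

end SchurDev

/-! ## §3 The Σ block: PART 10 §1 applied to the holomorphic small family `E` -/

section Sigma

variable {E : Type*} [NormedAddCommGroup E] [NormedSpace ℂ E] {T : E → (F →L[ℂ] F)} {U : Set E} (Q : F →L[ℂ] G) (R : G →L[ℂ] F)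

/-- **`differentiableOn_sigmaEntry` — ENTRIES OF THE SCHUR-COMPLEMENT BLOCK ARE JOINTLY HOLOMORPHIC** [our proof]: `T` holomorphic on the open `U` with
`‖T z‖ ≤ ϑ < 1`, `Q R = 1` not even needed here, and the smallness `‖Q‖‖R‖ϑ∕(1−ϑ) < 1` ⇒ for `ψ : G →L[ℂ] ℂ`, `g : G`,
`z ↦ ψ ((1 + Q ∘L ((1 + T z)⁻¹ʳ − 1) ∘L R)⁻¹ʳ g)` is holomorphic on `U` (PART 10's `differentiableOn_resolventEntry` for the family `E`). -/
theorem differentiableOn_sigmaEntry (hU : IsOpen U) (hT : DifferentiableOn ℂ T U) {ϑ : ℝ} (hϑT : ∀ z ∈ U, ‖T z‖ ≤ ϑ) (hϑ : ϑ < 1)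
    (hsmall : ‖Q‖ * ‖R‖ * (ϑ / (1 - ϑ)) < 1) (ψ : G →L[ℂ] ℂ) (g : G) :
    DifferentiableOn ℂ (fun z => ψ ((1 + Q.comp ((((1 + T z)⁻¹ʳ) - 1).comp R))⁻¹ʳ g)) U :=
  differentiableOn_resolventEntry (T := fun z => Q.comp ((((1 + T z)⁻¹ʳ) - 1).comp R)) hU
    (differentiableOn_schurDev Q R hU hT fun z hz => lt_of_le_of_lt (hϑT z hz) hϑ)
    (fun z hz => lt_of_le_of_lt (norm_schurDev_le Q R (hϑT z hz) hϑ) hsmall) ψ g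

omit [NormedAddCommGroup E] [NormedSpace ℂ E] in
/-- **`norm_sigmaEntry_le` — THE ONE BOUND FOR THE Σ BLOCK** [our proof]: with `‖Q‖‖R‖ϑ∕(1−ϑ) ≤ ϑ′ < 1`,
`‖ψ ((1 + E z)⁻¹ʳ g)‖ ≤ ‖ψ‖·‖g‖∕(1 − ϑ′)`. -/
theorem norm_sigmaEntry_le {ϑ ϑ' : ℝ} {z : E} (hT : ‖T z‖ ≤ ϑ) (hϑ : ϑ < 1)
    (hsmall : ‖Q‖ * ‖R‖ * (ϑ / (1 - ϑ)) ≤ ϑ') (hϑ' : ϑ' < 1) (ψ : G →L[ℂ] ℂ) (g : G) :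
    ‖ψ ((1 + Q.comp ((((1 + T z)⁻¹ʳ) - 1).comp R))⁻¹ʳ g)‖ ≤ ‖ψ‖ * ‖g‖ / (1 - ϑ') :=
  norm_resolventEntry_le (T := fun z => Q.comp ((((1 + T z)⁻¹ʳ) - 1).comp R)) (z := z)
    ((norm_schurDev_le Q R hT hϑ).trans hsmall) hϑ' ψ g

end Sigma

/-! ## §4 The Ξ block `Σ(z) Q K(z)⁻¹`: products of holomorphic bounded factors -/

section Xi

variable {E : Type*} [NormedAddCommGroup E] [NormedSpace ℂ E] {T : E → (F →L[ℂ] F)} {U : Set E} (Q : F →L[ℂ] G) (R : G →L[ℂ] F)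

/-- **`differentiableOn_xiEntry` — ENTRIES OF THE OFF-DIAGONAL BLOCK ARE JOINTLY HOLOMORPHIC** [our proof]: under the hypotheses of
`differentiableOn_sigmaEntry`, for `ψ : G →L[ℂ] ℂ` and `f : F`, `z ↦ ψ ((1 + E z)⁻¹ʳ (Q ((1 + T z)⁻¹ʳ f)))` is holomorphic on `U`. -/
theorem differentiableOn_xiEntry (hU : IsOpen U) (hT : DifferentiableOn ℂ T U) {ϑ : ℝ} (hϑT : ∀ z ∈ U, ‖T z‖ ≤ ϑ) (hϑ : ϑ < 1)
    (hsmall : ‖Q‖ * ‖R‖ * (ϑ / (1 - ϑ)) < 1) (ψ : G →L[ℂ] ℂ) (f : F) :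
    DifferentiableOn ℂ (fun z => ψ ((1 + Q.comp ((((1 + T z)⁻¹ʳ) - 1).comp R))⁻¹ʳ (Q ((1 + T z)⁻¹ʳ f)))) U := by
  have h1 : ∀ z ∈ U, ‖T z‖ < 1 := fun z hz => lt_of_le_of_lt (hϑT z hz) hϑ
  -- the Σ factor as a CLM-valued holomorphic map
  have hE : DifferentiableOn ℂ (fun z => Q.comp ((((1 + T z)⁻¹ʳ) - 1).comp R)) U := differentiableOn_schurDev Q R hU hT h1
  have hSig : DifferentiableOn ℂ (fun z => (1 + Q.comp ((((1 + T z)⁻¹ʳ) - 1).comp R))⁻¹ʳ) U :=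
    differentiableOn_inverse_one_add (T := fun z => Q.comp ((((1 + T z)⁻¹ʳ) - 1).comp R)) hU hE
      fun z hz => lt_of_le_of_lt (norm_schurDev_le Q R (hϑT z hz) hϑ) hsmall
  -- the vector factor `Q ((1 + T z)⁻¹ʳ f)`
  have hv : DifferentiableOn ℂ (fun z => Q ((1 + T z)⁻¹ʳ f)) U :=
    (differentiableOn_const Q).clm_apply ((differentiableOn_inverse_one_add hU hT h1).clm_apply (differentiableOn_const f))
  exact (differentiableOn_const ψ).clm_apply (hSig.clm_apply hv)

omit [NormedAddCommGroup E] [NormedSpace ℂ E] in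
/-- **`norm_xiEntry_le` — THE ONE BOUND FOR THE Ξ BLOCK** [our proof]: `‖T z‖ ≤ ϑ < 1`, `‖Q‖‖R‖ϑ∕(1−ϑ) ≤ ϑ′ < 1` ⇒
`‖ψ ((1 + E z)⁻¹ʳ (Q ((1 + T z)⁻¹ʳ f)))‖ ≤ ‖ψ‖·‖Q‖·‖f‖∕((1−ϑ′)(1−ϑ))`. -/
theorem norm_xiEntry_le {ϑ ϑ' : ℝ} {z : E} (hT : ‖T z‖ ≤ ϑ) (hϑ : ϑ < 1)
    (hsmall : ‖Q‖ * ‖R‖ * (ϑ / (1 - ϑ)) ≤ ϑ') (hϑ' : ϑ' < 1) (ψ : G →L[ℂ] ℂ) (f : F) :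
    ‖ψ ((1 + Q.comp ((((1 + T z)⁻¹ʳ) - 1).comp R))⁻¹ʳ (Q ((1 + T z)⁻¹ʳ f)))‖ ≤
      ‖ψ‖ * ‖Q‖ * ‖f‖ / ((1 - ϑ') * (1 - ϑ)) := by
  have hSig := norm_sigmaEntry_le Q R hT hϑ hsmall hϑ' ψ (Q ((1 + T z)⁻¹ʳ f))
  have hv : ‖Q ((1 + T z)⁻¹ʳ f)‖ ≤ ‖Q‖ * (‖f‖ / (1 - ϑ)) :=
    (Q.le_opNorm _).trans (by gcongr; exact norm_inverse_one_add_apply_le (T z) hT hϑ f)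
  have h1ϑ' : 0 < 1 - ϑ' := by linarith
  have h1ϑ : 0 < 1 - ϑ := by linarith
  calc ‖ψ ((1 + Q.comp ((((1 + T z)⁻¹ʳ) - 1).comp R))⁻¹ʳ (Q ((1 + T z)⁻¹ʳ f)))‖
      ≤ ‖ψ‖ * ‖Q ((1 + T z)⁻¹ʳ f)‖ / (1 - ϑ') := hSig
    _ ≤ ‖ψ‖ * (‖Q‖ * (‖f‖ / (1 - ϑ))) / (1 - ϑ') := by gcongr
    _ = ‖ψ‖ * ‖Q‖ * ‖f‖ / ((1 - ϑ') * (1 - ϑ)) := by field_simp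

end Xi

end Summit.QuantumFields.BalabanUV.Beta.GAN24.DerivativeRateTransferAnalyticSchur

end
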